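import Literature.AlgebraicGeometry.AbelianSchemes.AbelianVarietyCechProductMaps
import HarnessLib

/-!
# The composites of the seven structure maps on `Ȟ•(A, 𝒪)`, `Ȟ•(A × A, 𝒪)` (Mumford AV §13): `i₁^* m^* = id`, `i₁^* p₂^* = 0`,
# `sw^* m^* = m^*`, `sw^* p₁^* = p₂^*`, …, and graded commutativity on the product cover

Layer `Literature/AlgebraicGeometry/AbelianSchemes`; namespace `Literature.AlgebraicGeometry.AbelianSchemes.AbelianVarietyCech`.  PROOF file
(theorems only) over ★ `AbelianVarietyCechProductMaps` (the maps `pOne pTwo mS swS iOne iTwo`, `rT`, `mT`).  The nine composite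
identities `hi₁m hi₂m hi₁p₁ hi₂p₂ hi₁p₂ hi₂p₁ hswm hswp₁ hswp₂` of the bialgebra assembly ★ `cup_one_one_surjective` are proved ON THE
NOSE from the scheme identities `i₁ ≫ m = 𝟙`, `i₁ ≫ p₂ = toUnit ≫ e`, `sw ≫ m = m`, `sw ≫ p₁ = p₂`, … (★ `AbelianSchemeProductCoverIndexMaps`)
by ★ functoriality of refinement on cochains (`refineCochain_comp`), ★ the constant index map (`homologyMap_eq_zero_of_refine_const`) and
★ `refineCochain_id_apply` — the composite index maps of the covers `U`, `W₀ = U ⊠ U`, `W = W₀ ∩ m⁻¹U` COINCIDE, so no chain homotopy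
(index-map independence) is needed; `m^* = (r^*)⁻¹ m_T^*` is handled through the lifts `swT^*, i₁T^*, i₂T^*` to the triple cover.
Also `hcomm` (★ `cupH_mulPairing_comm`).  [cite: MumfordAV1970, §13 Cor. 2 (p. 129)] [cite: StacksProject, Tag 01FP]
-/

noncomputable section

open CategoryTheory CategoryTheory.Limits CategoryTheory.MonoidalCategory AlgebraicGeometry TopologicalSpace Opposite
open HomologicalComplex TensorProduct Finset
open Literature.Algebra.Homology Literature.Algebra.Homology.OrderedCech Literature.AlgebraicGeometry.Modules
open Literature.AlgebraicGeometry.Morphisms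

set_option backward.isDefEq.respectTransparency false

namespace Literature.AlgebraicGeometry.AbelianSchemes.AbelianVarietyCech

universe u

section Assembly

variable {k : Type} [Field k] (A : AbelianSchemeOver (Spec (.of k)))
  {ι : Type} [LinearOrder ι] [Fintype ι] (U : ι → A.X.left.affineOpens) (hcov : ⨆ i, (U i).1 = ⊤)
  (W₀ : ι ×ₗ ι → (X2 A).affineOpens)
  (hW₀ : ∀ i j, (W₀ (toLex (i, j))).1 = p₁ A ⁻¹ᵁ (U i).1 ⊓ p₂ A ⁻¹ᵁ (U j).1)
  (W : (ι ×ₗ ι) ×ₗ ι → (X2 A).affineOpens)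
  (hW : ∀ c l, (W (toLex (c, l))).1 = (W₀ c).1 ⊓ m A ⁻¹ᵁ (U l).1)
  (j₀ : ι) (hj₀ : e A ⁻¹ᵁ (U j₀).1 = ⊤)

/-! ### The auxiliary pull-backs on the TRIPLE cover: `sw` and `i₁`, `i₂` lifted to `W` -/

omit [LinearOrder ι] [Fintype ι] in
include hW₀ hW in
/-- `θ_{swT}` is admissible: `W((i,j),l) ⊆ sw⁻¹ W((j,i),l)` (uses `sw ≫ m = m`). [cite: MumfordAV1970, §13 Cor. 2 (p. 129)] -/
theorem adm_swT (d : (ι ×ₗ ι) ×ₗ ι) : W' A W d ≤ sw A ⁻¹ᵁ W' A W ((toLex (toLex ((ofLex (ofLex d).1).2, (ofLex (ofLex d).1).1), (ofLex d).2))) := by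
  obtain ⟨c, l⟩ := d
  change (W (toLex (c, l))).1 ≤ sw A ⁻¹ᵁ (W (toLex (toLex ((ofLex c).2, (ofLex c).1), l))).1
  rw [hW, hW, Scheme.Hom.preimage_inf, ← Scheme.Hom.comp_preimage,
    show sw A ≫ m A = m A from AbelianSchemeOver.braiding_left_comp_mul_left A]
  exact inf_le_inf_right _ (AbelianSchemeOver.productCover_le_preimage_braiding A (U' A U) (W₀' A W₀) hW₀ c)

omit [LinearOrder ι] [Fintype ι] in
include hW₀ hW hj₀ in
/-- `θ_{i₁T}` is admissible: `U_i ⊆ i₁⁻¹ W((i,j₀),i)` (uses `i₁ ≫ m = 𝟙`). [cite: MumfordAV1970, §13 Cor. 2 (p. 129)] -/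
theorem adm_iOneT (i : ι) : U' A U i ≤ i₁ A ⁻¹ᵁ W' A W ((toLex (toLex (i, j₀), i))) := by
  change (U i).1 ≤ i₁ A ⁻¹ᵁ (W (toLex (toLex (i, j₀), i))).1
  rw [hW, Scheme.Hom.preimage_inf, ← Scheme.Hom.comp_preimage,
    show i₁ A ≫ m A = 𝟙 _ from AbelianSchemeOver.unitLeft_left_comp_mul_left A, Scheme.Hom.id_preimage]
  exact le_inf (AbelianSchemeOver.le_preimage_unitLeft_productCover A (U' A U) (W₀' A W₀) hW₀ j₀ hj₀ i) le_rfl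

omit [LinearOrder ι] [Fintype ι] in
include hW₀ hW hj₀ in
/-- `θ_{i₂T}` is admissible: `U_i ⊆ i₂⁻¹ W((j₀,i),i)` (uses `i₂ ≫ m = 𝟙`). [cite: MumfordAV1970, §13 Cor. 2 (p. 129)] -/
theorem adm_iTwoT (i : ι) : U' A U i ≤ i₂ A ⁻¹ᵁ W' A W ((toLex (toLex (j₀, i), i))) := by
  change (U i).1 ≤ i₂ A ⁻¹ᵁ (W (toLex (toLex (j₀, i), i))).1
  rw [hW, Scheme.Hom.preimage_inf, ← Scheme.Hom.comp_preimage,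
    show i₂ A ≫ m A = 𝟙 _ from AbelianSchemeOver.unitRight_left_comp_mul_left A, Scheme.Hom.id_preimage]
  exact le_inf (AbelianSchemeOver.le_preimage_unitRight_productCover A (U' A U) (W₀' A W₀) hW₀ j₀ hj₀ i) le_rfl

omit [Fintype ι] in
include hW₀ in
/-- `r^* ∘ sw^* = swT^* ∘ r^*` (both are the pull-back along `sw` from `W₀` to `W`, same index map). [cite: MumfordAV1970, §13 Cor. 2 (p. 129)] -/
theorem rT_swS (n : ℕ) (z : (CS A W₀).homology (n : ℤ)) :
    rT A U W₀ W hW n (swS A U W₀ hW₀ n z) = (HomologicalComplex.homologyMap (refineComplexMap (fun d : (ι ×ₗ ι) ×ₗ ι => toLex (toLex ((ofLex (ofLex d).1).2, (ofLex (ofLex d).1).1), (ofLex d).2))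
      (pullbackSystemHom (sw A) (W' A W) (W' A W)
      (fun d : (ι ×ₗ ι) ×ₗ ι => toLex (toLex ((ofLex (ofLex d).1).2, (ofLex (ofLex d).1).1), (ofLex d).2)) (adm_swT A U W₀ hW₀ W hW) (ρ₂ A) (ρ₂ A) (hρ_sw A))) (n : ℤ)).hom (rT A U W₀ W hW n z) := by
  rw [homologyMap_comp_apply, homologyMap_comp_apply]
  have hadm₁ := adm_comp _ _ _ _ _ _ _ (AbelianSchemeOver.productCover_le_preimage_braiding A (U' A U) (W₀' A W₀) hW₀)
    (AbelianSchemeOver.refinedCover_le_productCover A (U' A U) (W₀' A W₀) (W' A W) hW)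
  have hρc₁ := hρ_comp _ _ (ρ₂ A) (ρ₂ A) (ρ₂ A) (hρ_sw A) (hρ_r A)
  have hadm₂ := adm_comp _ _ _ _ _ _ _ (AbelianSchemeOver.refinedCover_le_productCover A (U' A U) (W₀' A W₀) (W' A W) hW)
    (adm_swT A U W₀ hW₀ W hW)
  have hρc₂ := hρ_comp _ _ (ρ₂ A) (ρ₂ A) (ρ₂ A) (hρ_r A) (hρ_sw A)
  have hF : refineComplexMap _ (φsw A U W₀ hW₀) ≫ refineComplexMap _ (φr A U W₀ W hW) =
      refineComplexMap _ (φr A U W₀ W hW) ≫ refineComplexMap _ ((pullbackSystemHom (sw A) (W' A W) (W' A W)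
      (fun d : (ι ×ₗ ι) ×ₗ ι => toLex (toLex ((ofLex (ofLex d).1).2, (ofLex (ofLex d).1).1), (ofLex d).2)) (adm_swT A U W₀ hW₀ W hW) (ρ₂ A) (ρ₂ A) (hρ_sw A))) := by
    refine hom_ext_apply fun m g => ?_
    change refineCochain _ (φr A U W₀ W hW) m (refineCochain _ (φsw A U W₀ hW₀) m g) =
      refineCochain _ ((pullbackSystemHom (sw A) (W' A W) (W' A W)
      (fun d : (ι ×ₗ ι) ×ₗ ι => toLex (toLex ((ofLex (ofLex d).1).2, (ofLex (ofLex d).1).1), (ofLex d).2)) (adm_swT A U W₀ hW₀ W hW) (ρ₂ A) (ρ₂ A) (hρ_sw A))) m (refineCochain _ (φr A U W₀ W hW) m g)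
    rw [refineCochain_comp _ _ _ _ (pullbackSystemHom (𝟙 _ ≫ sw A) (W₀' A W₀) (W' A W) _ hadm₁ (ρ₂ A) (ρ₂ A) hρc₁)
        (pullbackSystemHom_comp_app _ _ _ _ _ _ _ _ _ _ _ _ _ _ _ _),
      refineCochain_comp _ _ _ _ (pullbackSystemHom (sw A ≫ 𝟙 _) (W₀' A W₀) (W' A W) _ hadm₂ (ρ₂ A) (ρ₂ A) hρc₂)
        (pullbackSystemHom_comp_app _ _ _ _ _ _ _ _ _ _ _ _ _ _ _ _)]
    funext σ'
    rw [refineCochain_apply, refineCochain_apply]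
    exact pullbackSystemHom_congr (by simp) (W₀' A W₀) (W' A W) _ hadm₁ hadm₂ (ρ₂ A) (ρ₂ A) hρc₁ hρc₂ σ'.1 _
  rw [hF]

omit [Fintype ι] in
/-- `swT^* ∘ m_T^* = m_T^*` (`sw ≫ m = m`, same index map). [cite: MumfordAV1970, §13 Cor. 2 (p. 129)] -/
theorem swT_mT (n : ℕ) (y : (CA A U).homology (n : ℤ)) :
    (HomologicalComplex.homologyMap (refineComplexMap (fun d : (ι ×ₗ ι) ×ₗ ι => toLex (toLex ((ofLex (ofLex d).1).2, (ofLex (ofLex d).1).1), (ofLex d).2))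
      (pullbackSystemHom (sw A) (W' A W) (W' A W)
      (fun d : (ι ×ₗ ι) ×ₗ ι => toLex (toLex ((ofLex (ofLex d).1).2, (ofLex (ofLex d).1).1), (ofLex d).2)) (adm_swT A U W₀ hW₀ W hW) (ρ₂ A) (ρ₂ A) (hρ_sw A))) (n : ℤ)).hom (mT A U W₀ W hW n y) = mT A U W₀ W hW n y := by
  rw [homologyMap_comp_apply]
  have hadm := adm_comp _ _ _ _ _ _ _ (AbelianSchemeOver.refinedCover_le_preimage_mul A (U' A U) (W₀' A W₀) (W' A W) hW)
    (adm_swT A U W₀ hW₀ W hW)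
  have hρc := hρ_comp _ _ (ρ₁ A) (ρ₂ A) (ρ₂ A) (hρ_m A) (hρ_sw A)
  have hF : refineComplexMap _ (φm A U W₀ W hW) ≫ refineComplexMap _ ((pullbackSystemHom (sw A) (W' A W) (W' A W)
      (fun d : (ι ×ₗ ι) ×ₗ ι => toLex (toLex ((ofLex (ofLex d).1).2, (ofLex (ofLex d).1).1), (ofLex d).2)) (adm_swT A U W₀ hW₀ W hW) (ρ₂ A) (ρ₂ A) (hρ_sw A))) =
      refineComplexMap _ (φm A U W₀ W hW) := by
    refine hom_ext_apply fun m' g => ?_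
    change refineCochain _ ((pullbackSystemHom (sw A) (W' A W) (W' A W)
      (fun d : (ι ×ₗ ι) ×ₗ ι => toLex (toLex ((ofLex (ofLex d).1).2, (ofLex (ofLex d).1).1), (ofLex d).2)) (adm_swT A U W₀ hW₀ W hW) (ρ₂ A) (ρ₂ A) (hρ_sw A))) m' (refineCochain _ (φm A U W₀ W hW) m' g) =
      refineCochain _ (φm A U W₀ W hW) m' g
    rw [refineCochain_comp _ _ _ _ (pullbackSystemHom (sw A ≫ m A) (U' A U) (W' A W) _ hadm (ρ₁ A) (ρ₂ A) hρc)
        (pullbackSystemHom_comp_app _ _ _ _ _ _ _ _ _ _ _ _ _ _ _ _)]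
    funext σ'
    rw [refineCochain_apply, refineCochain_apply]
    exact pullbackSystemHom_congr (AbelianSchemeOver.braiding_left_comp_mul_left A) (U' A U) (W' A W) _ hadm
      (AbelianSchemeOver.refinedCover_le_preimage_mul A (U' A U) (W₀' A W₀) (W' A W) hW) (ρ₁ A) (ρ₂ A) hρc (hρ_m A) σ'.1 _
  rw [hF]

omit [Fintype ι] in
include hW₀ in
/-- `i₁T^* ∘ r^* = i₁^*`. [cite: MumfordAV1970, §13 Cor. 2 (p. 129)] -/
theorem iOneT_rT (n : ℕ) (z : (CS A W₀).homology (n : ℤ)) :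
    (HomologicalComplex.homologyMap (refineComplexMap (fun i : ι => toLex (toLex (i, j₀), i))
      (pullbackSystemHom (i₁ A) (W' A W) (U' A U) (fun i : ι => toLex (toLex (i, j₀), i))
      (adm_iOneT A U W₀ hW₀ W hW j₀ hj₀) (ρ₂ A) (ρ₁ A) (hρ_i₁ A))) (n : ℤ)).hom (rT A U W₀ W hW n z) = iOne A U W₀ hW₀ j₀ hj₀ n z := by
  rw [homologyMap_comp_apply]
  have hadm := adm_comp _ _ _ _ _ _ _ (AbelianSchemeOver.refinedCover_le_productCover A (U' A U) (W₀' A W₀) (W' A W) hW)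
    (adm_iOneT A U W₀ hW₀ W hW j₀ hj₀)
  have hρc := hρ_comp _ _ (ρ₂ A) (ρ₂ A) (ρ₁ A) (hρ_r A) (hρ_i₁ A)
  have hF : refineComplexMap _ (φr A U W₀ W hW) ≫ refineComplexMap _ ((pullbackSystemHom (i₁ A) (W' A W) (U' A U) (fun i : ι => toLex (toLex (i, j₀), i))
      (adm_iOneT A U W₀ hW₀ W hW j₀ hj₀) (ρ₂ A) (ρ₁ A) (hρ_i₁ A))) =
      refineComplexMap _ (φi₁ A U W₀ hW₀ j₀ hj₀) := by
    refine hom_ext_apply fun m' g => ?_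
    change refineCochain _ ((pullbackSystemHom (i₁ A) (W' A W) (U' A U) (fun i : ι => toLex (toLex (i, j₀), i))
      (adm_iOneT A U W₀ hW₀ W hW j₀ hj₀) (ρ₂ A) (ρ₁ A) (hρ_i₁ A))) m' (refineCochain _ (φr A U W₀ W hW) m' g) =
      refineCochain _ (φi₁ A U W₀ hW₀ j₀ hj₀) m' g
    rw [refineCochain_comp _ _ _ _ (pullbackSystemHom (i₁ A ≫ 𝟙 _) (W₀' A W₀) (U' A U) _ hadm (ρ₂ A) (ρ₁ A) hρc)
        (pullbackSystemHom_comp_app _ _ _ _ _ _ _ _ _ _ _ _ _ _ _ _)]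
    funext σ'
    rw [refineCochain_apply, refineCochain_apply]
    exact pullbackSystemHom_congr (Category.comp_id _) (W₀' A W₀) (U' A U) _ hadm
      (AbelianSchemeOver.le_preimage_unitLeft_productCover A (U' A U) (W₀' A W₀) hW₀ j₀ hj₀) (ρ₂ A) (ρ₁ A) hρc (hρ_i₁ A)
      σ'.1 _
  rw [hF]

omit [Fintype ι] in
include hW₀ in
/-- `i₂T^* ∘ r^* = i₂^*`. [cite: MumfordAV1970, §13 Cor. 2 (p. 129)] -/
theorem iTwoT_rT (n : ℕ) (z : (CS A W₀).homology (n : ℤ)) :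
    (HomologicalComplex.homologyMap (refineComplexMap (fun i : ι => toLex (toLex (j₀, i), i))
      (pullbackSystemHom (i₂ A) (W' A W) (U' A U) (fun i : ι => toLex (toLex (j₀, i), i))
      (adm_iTwoT A U W₀ hW₀ W hW j₀ hj₀) (ρ₂ A) (ρ₁ A) (hρ_i₂ A))) (n : ℤ)).hom (rT A U W₀ W hW n z) = iTwo A U W₀ hW₀ j₀ hj₀ n z := by
  rw [homologyMap_comp_apply]
  have hadm := adm_comp _ _ _ _ _ _ _ (AbelianSchemeOver.refinedCover_le_productCover A (U' A U) (W₀' A W₀) (W' A W) hW)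
    (adm_iTwoT A U W₀ hW₀ W hW j₀ hj₀)
  have hρc := hρ_comp _ _ (ρ₂ A) (ρ₂ A) (ρ₁ A) (hρ_r A) (hρ_i₂ A)
  have hF : refineComplexMap _ (φr A U W₀ W hW) ≫ refineComplexMap _ ((pullbackSystemHom (i₂ A) (W' A W) (U' A U) (fun i : ι => toLex (toLex (j₀, i), i))
      (adm_iTwoT A U W₀ hW₀ W hW j₀ hj₀) (ρ₂ A) (ρ₁ A) (hρ_i₂ A))) =
      refineComplexMap _ (φi₂ A U W₀ hW₀ j₀ hj₀) := by
    refine hom_ext_apply fun m' g => ?_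
    change refineCochain _ ((pullbackSystemHom (i₂ A) (W' A W) (U' A U) (fun i : ι => toLex (toLex (j₀, i), i))
      (adm_iTwoT A U W₀ hW₀ W hW j₀ hj₀) (ρ₂ A) (ρ₁ A) (hρ_i₂ A))) m' (refineCochain _ (φr A U W₀ W hW) m' g) =
      refineCochain _ (φi₂ A U W₀ hW₀ j₀ hj₀) m' g
    rw [refineCochain_comp _ _ _ _ (pullbackSystemHom (i₂ A ≫ 𝟙 _) (W₀' A W₀) (U' A U) _ hadm (ρ₂ A) (ρ₁ A) hρc)
        (pullbackSystemHom_comp_app _ _ _ _ _ _ _ _ _ _ _ _ _ _ _ _)]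
    funext σ'
    rw [refineCochain_apply, refineCochain_apply]
    exact pullbackSystemHom_congr (Category.comp_id _) (W₀' A W₀) (U' A U) _ hadm
      (AbelianSchemeOver.le_preimage_unitRight_productCover A (U' A U) (W₀' A W₀) hW₀ j₀ hj₀) (ρ₂ A) (ρ₁ A) hρc (hρ_i₂ A)
      σ'.1 _
  rw [hF]

omit [Fintype ι] in
include hW₀ in
/-- `i₁T^* ∘ m_T^* = id` (`i₁ ≫ m = 𝟙`, composite index map the identity). [cite: MumfordAV1970, §13 Cor. 2 (p. 129)] -/
theorem iOneT_mT (n : ℕ) (y : (CA A U).homology (n : ℤ)) :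
    (HomologicalComplex.homologyMap (refineComplexMap (fun i : ι => toLex (toLex (i, j₀), i))
      (pullbackSystemHom (i₁ A) (W' A W) (U' A U) (fun i : ι => toLex (toLex (i, j₀), i))
      (adm_iOneT A U W₀ hW₀ W hW j₀ hj₀) (ρ₂ A) (ρ₁ A) (hρ_i₁ A))) (n : ℤ)).hom (mT A U W₀ W hW n y) = y := by
  rw [homologyMap_comp_apply]
  refine homologyMap_apply_eq_self_of (fun m' g => ?_) _ y
  change refineCochain _ ((pullbackSystemHom (i₁ A) (W' A W) (U' A U) (fun i : ι => toLex (toLex (i, j₀), i))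
      (adm_iOneT A U W₀ hW₀ W hW j₀ hj₀) (ρ₂ A) (ρ₁ A) (hρ_i₁ A))) m' (refineCochain _ (φm A U W₀ W hW) m' g) = g
  have hadm := adm_comp _ _ _ _ _ _ _ (AbelianSchemeOver.refinedCover_le_preimage_mul A (U' A U) (W₀' A W₀) (W' A W) hW)
    (adm_iOneT A U W₀ hW₀ W hW j₀ hj₀)
  have hρc := hρ_comp _ _ (ρ₁ A) (ρ₂ A) (ρ₁ A) (hρ_m A) (hρ_i₁ A)
  rw [refineCochain_comp _ _ _ _ (pullbackSystemHom (i₁ A ≫ m A) (U' A U) (U' A U) _ hadm (ρ₁ A) (ρ₁ A) hρc)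
    (pullbackSystemHom_comp_app _ _ _ _ _ _ _ _ _ _ _ _ _ _ _ _)]
  have himg : ∀ s : Finset ι, s.image ((fun d : (ι ×ₗ ι) ×ₗ ι => (ofLex d).2) ∘ (fun i : ι => toLex (toLex (i, j₀), i))) ⊆ s := fun s i hi => by
    obtain ⟨j, hj, rfl⟩ := Finset.mem_image.mp hi
    exact hj
  refine refineCochain_id_apply ((fun d : (ι ×ₗ ι) ×ₗ ι => (ofLex d).2) ∘ (fun i : ι => toLex (toLex (i, j₀), i))) (fun i => rfl) _ himg
    (fun s x => ?_) m' g
  rw [pullbackSystemHom_congr (AbelianSchemeOver.unitLeft_left_comp_mul_left A) (U' A U) (U' A U) _ hadm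
    (fun i => le_rfl) (ρ₁ A) (ρ₁ A) hρc (fun a => by simp) s x]
  exact pullbackSystemHom_id_app (U' A U) _ himg (fun i => le_rfl) (ρ₁ A) (fun a => by simp) s x

omit [Fintype ι] in
include hW₀ in
/-- `i₂T^* ∘ m_T^* = id`. [cite: MumfordAV1970, §13 Cor. 2 (p. 129)] -/
theorem iTwoT_mT (n : ℕ) (y : (CA A U).homology (n : ℤ)) :
    (HomologicalComplex.homologyMap (refineComplexMap (fun i : ι => toLex (toLex (j₀, i), i))
      (pullbackSystemHom (i₂ A) (W' A W) (U' A U) (fun i : ι => toLex (toLex (j₀, i), i))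
      (adm_iTwoT A U W₀ hW₀ W hW j₀ hj₀) (ρ₂ A) (ρ₁ A) (hρ_i₂ A))) (n : ℤ)).hom (mT A U W₀ W hW n y) = y := by
  rw [homologyMap_comp_apply]
  refine homologyMap_apply_eq_self_of (fun m' g => ?_) _ y
  change refineCochain _ ((pullbackSystemHom (i₂ A) (W' A W) (U' A U) (fun i : ι => toLex (toLex (j₀, i), i))
      (adm_iTwoT A U W₀ hW₀ W hW j₀ hj₀) (ρ₂ A) (ρ₁ A) (hρ_i₂ A))) m' (refineCochain _ (φm A U W₀ W hW) m' g) = g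
  have hadm := adm_comp _ _ _ _ _ _ _ (AbelianSchemeOver.refinedCover_le_preimage_mul A (U' A U) (W₀' A W₀) (W' A W) hW)
    (adm_iTwoT A U W₀ hW₀ W hW j₀ hj₀)
  have hρc := hρ_comp _ _ (ρ₁ A) (ρ₂ A) (ρ₁ A) (hρ_m A) (hρ_i₂ A)
  rw [refineCochain_comp _ _ _ _ (pullbackSystemHom (i₂ A ≫ m A) (U' A U) (U' A U) _ hadm (ρ₁ A) (ρ₁ A) hρc)
    (pullbackSystemHom_comp_app _ _ _ _ _ _ _ _ _ _ _ _ _ _ _ _)]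
  have himg : ∀ s : Finset ι, s.image ((fun d : (ι ×ₗ ι) ×ₗ ι => (ofLex d).2) ∘ (fun i : ι => toLex (toLex (j₀, i), i))) ⊆ s := fun s i hi => by
    obtain ⟨j, hj, rfl⟩ := Finset.mem_image.mp hi
    exact hj
  refine refineCochain_id_apply ((fun d : (ι ×ₗ ι) ×ₗ ι => (ofLex d).2) ∘ (fun i : ι => toLex (toLex (j₀, i), i))) (fun i => rfl) _ himg
    (fun s x => ?_) m' g
  rw [pullbackSystemHom_congr (AbelianSchemeOver.unitRight_left_comp_mul_left A) (U' A U) (U' A U) _ hadm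
    (fun i => le_rfl) (ρ₁ A) (ρ₁ A) hρc (fun a => by simp) s x]
  exact pullbackSystemHom_id_app (U' A U) _ himg (fun i => le_rfl) (ρ₁ A) (fun a => by simp) s x

/-! ### (G1-c) the composites (★ `refineCochain_comp`, ★ `refineCochain_const_eq_zero`, identity index maps) -/

include hcov hW₀ in
/-- **`i₁^* ∘ m^* = id`** on `Ȟ•(A, 𝒪)` (`m ∘ (id, e) = id`). [cite: MumfordAV1970, §13 Cor. 2 (p. 129)] -/
theorem hi₁m (n : ℕ) (y : (CA A U).homology (n : ℤ)) :
    iOne A U W₀ hW₀ j₀ hj₀ n (mS A U hcov W₀ hW₀ W hW n y) = y := by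
  change iOne A U W₀ hW₀ j₀ hj₀ n ((LinearEquiv.ofBijective (rT A U W₀ W hW n)
    (rT_bijective A U hcov W₀ hW₀ W hW n)).symm (mT A U W₀ W hW n y)) = y
  rw [← iOneT_rT A U W₀ hW₀ W hW j₀ hj₀, ← LinearEquiv.ofBijective_apply (hf := rT_bijective A U hcov W₀ hW₀ W hW n),
    LinearEquiv.apply_symm_apply, iOneT_mT A U W₀ hW₀ W hW j₀ hj₀]

include hcov hW₀ in
/-- **`i₂^* ∘ m^* = id`** (`m ∘ (e, id) = id`). [cite: MumfordAV1970, §13 Cor. 2 (p. 129)] -/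
theorem hi₂m (n : ℕ) (y : (CA A U).homology (n : ℤ)) :
    iTwo A U W₀ hW₀ j₀ hj₀ n (mS A U hcov W₀ hW₀ W hW n y) = y := by
  change iTwo A U W₀ hW₀ j₀ hj₀ n ((LinearEquiv.ofBijective (rT A U W₀ W hW n)
    (rT_bijective A U hcov W₀ hW₀ W hW n)).symm (mT A U W₀ W hW n y)) = y
  rw [← iTwoT_rT A U W₀ hW₀ W hW j₀ hj₀, ← LinearEquiv.ofBijective_apply (hf := rT_bijective A U hcov W₀ hW₀ W hW n),
    LinearEquiv.apply_symm_apply, iTwoT_mT A U W₀ hW₀ W hW j₀ hj₀]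

omit [Fintype ι] in
/-- **`i₁^* ∘ p₁^* = id`** (`p₁ ∘ (id, e) = id`). [cite: MumfordAV1970, §13 Cor. 2 (p. 129)] -/
theorem hi₁p₁ (n : ℕ) (y : (CA A U).homology (n : ℤ)) :
    iOne A U W₀ hW₀ j₀ hj₀ n (pOne A U W₀ hW₀ n y) = y := by
  rw [homologyMap_comp_apply]
  refine homologyMap_apply_eq_self_of (fun m g => ?_) _ y
  change refineCochain _ (φi₁ A U W₀ hW₀ j₀ hj₀) m (refineCochain _ (φp₁ A U W₀ hW₀) m g) = g
  have hadm := adm_comp _ _ _ _ _ _ _ (AbelianSchemeOver.productCover_le_preimage_fst A (U' A U) (W₀' A W₀) hW₀)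
    (AbelianSchemeOver.le_preimage_unitLeft_productCover A (U' A U) (W₀' A W₀) hW₀ j₀ hj₀)
  have hρc := hρ_comp _ _ (ρ₁ A) (ρ₂ A) (ρ₁ A) (hρ_p₁ A) (hρ_i₁ A)
  rw [refineCochain_comp _ _ _ _ (pullbackSystemHom (i₁ A ≫ p₁ A) (U' A U) (U' A U) _ hadm (ρ₁ A) (ρ₁ A) hρc)
    (pullbackSystemHom_comp_app _ _ _ _ _ _ _ _ _ _ _ _ _ _ _ _)]
  have himg : ∀ s : Finset ι, s.image ((fun c : ι ×ₗ ι => (ofLex c).1) ∘ fun i : ι => toLex (i, j₀)) ⊆ s := fun s i hi => by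
    obtain ⟨j, hj, rfl⟩ := Finset.mem_image.mp hi
    exact hj
  refine refineCochain_id_apply ((fun c : ι ×ₗ ι => (ofLex c).1) ∘ fun i : ι => toLex (i, j₀)) (fun i => rfl) _ himg
    (fun s x => ?_) m g
  rw [pullbackSystemHom_congr (AbelianSchemeOver.unitLeft_left_comp_fst_left A) (U' A U) (U' A U) _ hadm
    (fun i => le_rfl) (ρ₁ A) (ρ₁ A) hρc (fun a => by simp) s x]
  exact pullbackSystemHom_id_app (U' A U) _ himg (fun i => le_rfl) (ρ₁ A) (fun a => by simp) s x

omit [Fintype ι] in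
/-- **`i₂^* ∘ p₂^* = id`**. [cite: MumfordAV1970, §13 Cor. 2 (p. 129)] -/
theorem hi₂p₂ (n : ℕ) (y : (CA A U).homology (n : ℤ)) :
    iTwo A U W₀ hW₀ j₀ hj₀ n (pTwo A U W₀ hW₀ n y) = y := by
  rw [homologyMap_comp_apply]
  refine homologyMap_apply_eq_self_of (fun m g => ?_) _ y
  change refineCochain _ (φi₂ A U W₀ hW₀ j₀ hj₀) m (refineCochain _ (φp₂ A U W₀ hW₀) m g) = g
  have hadm := adm_comp _ _ _ _ _ _ _ (AbelianSchemeOver.productCover_le_preimage_snd A (U' A U) (W₀' A W₀) hW₀)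
    (AbelianSchemeOver.le_preimage_unitRight_productCover A (U' A U) (W₀' A W₀) hW₀ j₀ hj₀)
  have hρc := hρ_comp _ _ (ρ₁ A) (ρ₂ A) (ρ₁ A) (hρ_p₂ A) (hρ_i₂ A)
  rw [refineCochain_comp _ _ _ _ (pullbackSystemHom (i₂ A ≫ p₂ A) (U' A U) (U' A U) _ hadm (ρ₁ A) (ρ₁ A) hρc)
    (pullbackSystemHom_comp_app _ _ _ _ _ _ _ _ _ _ _ _ _ _ _ _)]
  have himg : ∀ s : Finset ι, s.image ((fun c : ι ×ₗ ι => (ofLex c).2) ∘ fun i : ι => toLex (j₀, i)) ⊆ s := fun s i hi => by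
    obtain ⟨j, hj, rfl⟩ := Finset.mem_image.mp hi
    exact hj
  refine refineCochain_id_apply ((fun c : ι ×ₗ ι => (ofLex c).2) ∘ fun i : ι => toLex (j₀, i)) (fun i => rfl) _ himg
    (fun s x => ?_) m g
  rw [pullbackSystemHom_congr (AbelianSchemeOver.unitRight_left_comp_snd_left A) (U' A U) (U' A U) _ hadm
    (fun i => le_rfl) (ρ₁ A) (ρ₁ A) hρc (fun a => by simp) s x]
  exact pullbackSystemHom_id_app (U' A U) _ himg (fun i => le_rfl) (ρ₁ A) (fun a => by simp) s x

omit [Fintype ι] in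
/-- **`i₁^* ∘ p₂^* = 0` on `Ȟ^{≥1}`** (`p₂ ∘ (id, e)` is constant: constant index map). [cite: MumfordAV1970, §13 Cor. 2 (p. 129)] -/
theorem hi₁p₂ (n : ℕ) (hn : 1 ≤ n) (y : (CA A U).homology (n : ℤ)) :
    iOne A U W₀ hW₀ j₀ hj₀ n (pTwo A U W₀ hW₀ n y) = 0 := by
  rw [homologyMap_comp_apply]
  have hadm := adm_comp _ _ _ _ _ _ _ (AbelianSchemeOver.productCover_le_preimage_snd A (U' A U) (W₀' A W₀) hW₀)
    (AbelianSchemeOver.le_preimage_unitLeft_productCover A (U' A U) (W₀' A W₀) hW₀ j₀ hj₀)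
  have hρc := hρ_comp _ _ (ρ₁ A) (ρ₂ A) (ρ₁ A) (hρ_p₂ A) (hρ_i₁ A)
  have hF := homologyMap_eq_zero_of_refine_const j₀
    (pullbackSystemHom (i₁ A ≫ p₂ A) (U' A U) (U' A U) _ hadm (ρ₁ A) (ρ₁ A) hρc)
    (refineComplexMap _ (φp₂ A U W₀ hW₀) ≫ refineComplexMap _ (φi₁ A U W₀ hW₀ j₀ hj₀)) (n := (n : ℤ))
    (by exact_mod_cast hn) (fun g => by
      change refineCochain _ (φi₁ A U W₀ hW₀ j₀ hj₀) _ (refineCochain _ (φp₂ A U W₀ hW₀) _ g) = _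
      rw [refineCochain_comp _ _ _ _ (pullbackSystemHom (i₁ A ≫ p₂ A) (U' A U) (U' A U) _ hadm (ρ₁ A) (ρ₁ A) hρc)
        (pullbackSystemHom_comp_app _ _ _ _ _ _ _ _ _ _ _ _ _ _ _ _)]
      rfl)
  rw [hF]
  rfl

omit [Fintype ι] in
/-- **`i₂^* ∘ p₁^* = 0` on `Ȟ^{≥1}`**. [cite: MumfordAV1970, §13 Cor. 2 (p. 129)] -/
theorem hi₂p₁ (n : ℕ) (hn : 1 ≤ n) (y : (CA A U).homology (n : ℤ)) :
    iTwo A U W₀ hW₀ j₀ hj₀ n (pOne A U W₀ hW₀ n y) = 0 := by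
  rw [homologyMap_comp_apply]
  have hadm := adm_comp _ _ _ _ _ _ _ (AbelianSchemeOver.productCover_le_preimage_fst A (U' A U) (W₀' A W₀) hW₀)
    (AbelianSchemeOver.le_preimage_unitRight_productCover A (U' A U) (W₀' A W₀) hW₀ j₀ hj₀)
  have hρc := hρ_comp _ _ (ρ₁ A) (ρ₂ A) (ρ₁ A) (hρ_p₁ A) (hρ_i₂ A)
  have hF := homologyMap_eq_zero_of_refine_const j₀
    (pullbackSystemHom (i₂ A ≫ p₁ A) (U' A U) (U' A U) _ hadm (ρ₁ A) (ρ₁ A) hρc)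
    (refineComplexMap _ (φp₁ A U W₀ hW₀) ≫ refineComplexMap _ (φi₂ A U W₀ hW₀ j₀ hj₀)) (n := (n : ℤ))
    (by exact_mod_cast hn) (fun g => by
      change refineCochain _ (φi₂ A U W₀ hW₀ j₀ hj₀) _ (refineCochain _ (φp₁ A U W₀ hW₀) _ g) = _
      rw [refineCochain_comp _ _ _ _ (pullbackSystemHom (i₂ A ≫ p₁ A) (U' A U) (U' A U) _ hadm (ρ₁ A) (ρ₁ A) hρc)
        (pullbackSystemHom_comp_app _ _ _ _ _ _ _ _ _ _ _ _ _ _ _ _)]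
      rfl)
  rw [hF]
  rfl

include hcov hW₀ in
/-- **`sw^* ∘ m^* = m^*`** (commutativity of the group law). [cite: MumfordAV1970, §13 Cor. 2 (p. 129)] -/
theorem hswm (n : ℕ) (y : (CA A U).homology (n : ℤ)) :
    swS A U W₀ hW₀ n (mS A U hcov W₀ hW₀ W hW n y) = mS A U hcov W₀ hW₀ W hW n y := by
  apply (rT_bijective A U hcov W₀ hW₀ W hW n).1
  change rT A U W₀ W hW n (swS A U W₀ hW₀ n ((LinearEquiv.ofBijective (rT A U W₀ W hW n)
    (rT_bijective A U hcov W₀ hW₀ W hW n)).symm (mT A U W₀ W hW n y))) =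
    rT A U W₀ W hW n ((LinearEquiv.ofBijective (rT A U W₀ W hW n)
      (rT_bijective A U hcov W₀ hW₀ W hW n)).symm (mT A U W₀ W hW n y))
  rw [rT_swS A U W₀ hW₀ W hW, ← LinearEquiv.ofBijective_apply (hf := rT_bijective A U hcov W₀ hW₀ W hW n),
    LinearEquiv.apply_symm_apply, swT_mT A U W₀ hW₀ W hW]

omit [Fintype ι] in
/-- **`sw^* ∘ p₁^* = p₂^*`**. [cite: MumfordAV1970, §13 Cor. 2 (p. 129)] -/
theorem hswp₁ (n : ℕ) (y : (CA A U).homology (n : ℤ)) :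
    swS A U W₀ hW₀ n (pOne A U W₀ hW₀ n y) = pTwo A U W₀ hW₀ n y := by
  rw [homologyMap_comp_apply]
  have hadm := adm_comp _ _ _ _ _ _ _ (AbelianSchemeOver.productCover_le_preimage_fst A (U' A U) (W₀' A W₀) hW₀)
    (AbelianSchemeOver.productCover_le_preimage_braiding A (U' A U) (W₀' A W₀) hW₀)
  have hρc := hρ_comp _ _ (ρ₁ A) (ρ₂ A) (ρ₂ A) (hρ_p₁ A) (hρ_sw A)
  have hF : refineComplexMap _ (φp₁ A U W₀ hW₀) ≫ refineComplexMap _ (φsw A U W₀ hW₀) =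
      refineComplexMap _ (φp₂ A U W₀ hW₀) := by
    refine hom_ext_apply fun m g => ?_
    change refineCochain _ (φsw A U W₀ hW₀) m (refineCochain _ (φp₁ A U W₀ hW₀) m g) = refineCochain _ (φp₂ A U W₀ hW₀) m g
    rw [refineCochain_comp _ _ _ _ (pullbackSystemHom (sw A ≫ p₁ A) (U' A U) (W₀' A W₀) _ hadm (ρ₁ A) (ρ₂ A) hρc)
      (pullbackSystemHom_comp_app _ _ _ _ _ _ _ _ _ _ _ _ _ _ _ _)]
    funext σ'
    rw [refineCochain_apply, refineCochain_apply]
    exact pullbackSystemHom_congr (AbelianSchemeOver.braiding_left_comp_fst_left A) (U' A U) (W₀' A W₀) _ hadm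
      (AbelianSchemeOver.productCover_le_preimage_snd A (U' A U) (W₀' A W₀) hW₀) (ρ₁ A) (ρ₂ A) hρc (hρ_p₂ A) σ'.1 _
  rw [hF]

omit [Fintype ι] in
/-- **`sw^* ∘ p₂^* = p₁^*`**. [cite: MumfordAV1970, §13 Cor. 2 (p. 129)] -/
theorem hswp₂ (n : ℕ) (y : (CA A U).homology (n : ℤ)) :
    swS A U W₀ hW₀ n (pTwo A U W₀ hW₀ n y) = pOne A U W₀ hW₀ n y := by
  rw [homologyMap_comp_apply]
  have hadm := adm_comp _ _ _ _ _ _ _ (AbelianSchemeOver.productCover_le_preimage_snd A (U' A U) (W₀' A W₀) hW₀)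
    (AbelianSchemeOver.productCover_le_preimage_braiding A (U' A U) (W₀' A W₀) hW₀)
  have hρc := hρ_comp _ _ (ρ₁ A) (ρ₂ A) (ρ₂ A) (hρ_p₂ A) (hρ_sw A)
  have hF : refineComplexMap _ (φp₂ A U W₀ hW₀) ≫ refineComplexMap _ (φsw A U W₀ hW₀) =
      refineComplexMap _ (φp₁ A U W₀ hW₀) := by
    refine hom_ext_apply fun m g => ?_
    change refineCochain _ (φsw A U W₀ hW₀) m (refineCochain _ (φp₂ A U W₀ hW₀) m g) = refineCochain _ (φp₁ A U W₀ hW₀) m g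
    rw [refineCochain_comp _ _ _ _ (pullbackSystemHom (sw A ≫ p₂ A) (U' A U) (W₀' A W₀) _ hadm (ρ₁ A) (ρ₂ A) hρc)
      (pullbackSystemHom_comp_app _ _ _ _ _ _ _ _ _ _ _ _ _ _ _ _)]
    funext σ'
    rw [refineCochain_apply, refineCochain_apply]
    exact pullbackSystemHom_congr (AbelianSchemeOver.braiding_left_comp_snd_left A) (U' A U) (W₀' A W₀) _ hadm
      (AbelianSchemeOver.productCover_le_preimage_fst A (U' A U) (W₀' A W₀) hW₀) (ρ₁ A) (ρ₂ A) hρc (hρ_p₁ A) σ'.1 _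
  rw [hF]

/-! ### (G2) graded commutativity on `Ȟ(W₀, 𝒪_{X×X})` — ★ B-p09 (g18) `cupH_mulPairing_comm` -/

include hcov hW₀ in
/-- **Graded commutativity on `Ȟ•(W₀, 𝒪_{A×A})`** (★ `cupH_mulPairing_comm`). [cite: MumfordAV1970, §13 Cor. 2 (p. 129)] -/
theorem hcomm (a b n : ℕ) (h : a + b = n) (y : (CS A W₀).homology (a : ℤ)) (z : (CS A W₀).homology (b : ℤ)) :
    cupS A W₀ a b n h y z = ((-1 : k) ^ (a * b)) • cupS A W₀ b a n (by omega) z y := by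
  haveI : Fintype (ι ×ₗ ι) := inferInstanceAs (Fintype (ι × ι))
  exact cupH_mulPairing_comm (W₀' A W₀) (ρ₂ A) (hW₀a A W₀) (hW₀cov A U hcov W₀ hW₀) a b n h y z

end Assembly

end Literature.AlgebraicGeometry.AbelianSchemes.AbelianVarietyCech

end
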